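import Mathlib
import HarnessLib
import Summits.CriticalPhenomena.PercolationContinuityZ3.Theorems.PercTreeValueTetrahedronHarrisGapStubCondHarris
import Summits.CriticalPhenomena.PercolationContinuityZ3.Theorems.PercTreeValueTetrahedronHarrisGapSandwich
import Summits.CriticalPhenomena.PercolationContinuityZ3.Theorems.PercTreeValueTetrahedronHarrisGapStubG
import Summits.CriticalPhenomena.PercolationContinuityZ3.Theorems.PercTreeValueTetrahedronHarrisGapStubOffCollarIdentity
import Summits.CriticalPhenomena.PercolationContinuityZ3.Theorems.PercTreeValueTetrahedronHarrisGapStubDeterminedByBlockCondProb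
import Summits.CriticalPhenomena.PercolationContinuityZ3.Theorems.PercTreeValueTetrahedronHarrisGapStubSetIntegralBlockCondProb
import Summits.CriticalPhenomena.PercolationContinuityZ3.Theorems.PercTreeValueTetrahedronHarrisGapStubCollarShellProbability
import Summits.CriticalPhenomena.PercolationContinuityZ3.Theorems.PercTreeValueTetrahedronHarrisGapStubCrossedPairSymmetry
import Summits.CriticalPhenomena.PercolationContinuityZ3.Theorems.PercTreeValueTetrahedronDisjointCoexistenceStubShellDecoupling
import Summits.CriticalPhenomena.PercolationContinuityZ3.Theorems.PercTreeValueTetrahedronDisjointCoexistenceStubRestrictProduct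
import Summits.CriticalPhenomena.PercolationContinuityZ3.Theorems.PercTreeValueTetrahedronDisjointCoexistenceStubMirrorRestrict
import Summits.CriticalPhenomena.PercolationContinuityZ3.Theorems.PercTreeValueTetrahedronDisjointCoexistenceStubConfineProduct
import Literature.Probability.Percolation.BlockResampling
import Literature.Probability.Percolation.SharpnessDCTProofs
import Literature.Probability.Percolation.PercolationProofs
import Literature.Probability.Percolation.FiniteEnergy
import Literature.Probability.Percolation.RSW
import Literature.Probability.Percolation.TwoPointFunction

/-!
# Route PercTreeValue — the rev-7 composition of line `SketchIdeator1` for the crux `TetrahedronHarrisGap`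
# (stmt-CriticalPhenomena-7799): X_B ∧ box restriction ∧ restricted gluing ⇒ the crux

Lead prover-line-stmt-CriticalPhenomena-7799-c3-0 (continuation c3), skeleton `Cruxes/TetrahedronHarrisGap/Lines/SketchIdeator1.lean`
rev 7, registered transfer stub `stub_cruxOfCollar`.  With `a_r = (r,r,0)`, `b_r = (r,0,r)`, `c_r = (0,r,r)`, `k = ⌊r/8⌋`,
`R = [−r,2r]² × [−2r,3k]` (the box of the sibling crux stmt-7798's registered open stub S5'), `R' = R + B(2k−1)` (roof `5k−1`),
`U = {x | r − 3k ≤ x₂}`, `K` = the finite set of pairs inside the closed collar `R' ∖ R`, `W = {0 ↔ a in R} ∩ {b ↔ c in U}` and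
`f = P(0 ↔ b | ω off K)` (`blockCondProb`):

* total covariance + conditional Harris in the block (`integral_blockCondProb_eq`, `measureReal_mul_le_integral_blockCondProb_mul`,
  `blockCondProb_mul_blockCondProb_le`): `P(A'∩B') − P(A')P(B') ≥ ∫ [P(A'∩B'|·) − P(A'|·)P(B'|·)]` for the CROSSED pair
  `A' = {0↔b}`, `B' = {a↔c}`, and the integrand is `≥ 0`;
* on `W` the three conditional probabilities coincide (`stub_offCollarIdentity`), so on `S = W ∩ {κ ≤ f}` the integrand is
  `f − f² ≥ κ(1 − f)`; `∫ 1_S (1−f) = P(S) − P(A' ∩ S) = P(S ∖ A')` (`stub_setIntegral_blockCondProb`);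
* `P(S ∖ A') ≥ P(S ∩ Shell(R,R')) = P(S) · P(Shell(R,R'))` — a closed collar separates `0 ∈ R` from `b ∉ R'`
  (`shellDecoupling_subset`), and `S` lives off `K` while the shell event lives on `K` (`bondPercolation_real_inter_of_disjoint`);
  `P(Shell) ≥ c_S = c_X^(51³)` (`stub_collarShellProbability`, from X_B);
* `P(S) ≥ (c_g − κ) P(W)` from restricted gluing `c_g P(W) ≤ P(W ∩ A') = ∫ 1_W f ≤ κ P(W) + P(S)`; take `κ = c_g/2`;
* `P(W) = P(0↔a in R) P(b↔c in U) ≥ (c τ(0,a))²` (`stub_restrictProduct`, `stub_mirrorRestrict`, box restriction);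
* `τ(0,b) = τ(a,c) = τ(0,a) = τ(b,c)`, `P(0↔a ∧ b↔c) = P(0↔b ∧ a↔c)` (`stub_crossedPairSymmetry`, `tau_opposite_edge_eq`).

Hence the crux formula with `δ = (c_g/2)² · c_S · c²`, `r₀ = max (max r₁ r₂) 64`.  The crux BY NAME from the three named inputs
is recorded in the companion file `PercTreeValueTetrahedronHarrisGapCollarReductionByName.lean`.
-/

noncomputable section

namespace Summit.CriticalPhenomena.PercolationContinuityZ3.Theorems.TetrahedronHarrisGap

open MeasureTheory
open Literature.Probability.Percolation Literature.Probability.LatticeModels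
open Summit.CriticalPhenomena.PercolationContinuityZ3.Theorems.TetrahedronDisjointCoexistence

set_option maxHeartbeats 400000 in
/-- **The rev-7 composition (registered transfer stub `stub_cruxOfCollar`).** X_B (stmt-0846, verbatim), BOX RESTRICTION
(7798's S5', verbatim) and RESTRICTED GLUING imply the crux formula of `TetrahedronHarrisGap`, unfolded, with
`δ = (c_g/2)² · c_S · c²` (`c_S = c_X^(51³)` the closed-collar constant). -/
theorem stub_cruxOfCollar
    (hXB : ∃ c : ℝ, 0 < c ∧ ∀ n : ℕ, 1 ≤ n →
      (bondPercolation (zdGraph 3) (criticalProbI 3)).real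
          {ω | ∃ x ∈ box 3 n, ∃ y ∈ innerBoundary (zdGraph 3) (box 3 (2 * n)),
            ω ∈ openConnIn ↑(box 3 (2 * n)) x y} ≤ 1 - c)
    (hBox : ∃ c : ℝ, 0 < c ∧ ∃ r₀ : ℕ, ∀ r : ℕ, r₀ ≤ r →
      c * tau 3 (criticalProbI 3) 0 ![(r : ℤ), (r : ℤ), 0] ≤
        (bondPercolation (zdGraph 3) (criticalProbI 3)).real
          (openConnIn
            {x : Site 3 | -(r : ℤ) ≤ x 0 ∧ x 0 ≤ 2 * (r : ℤ) ∧ -(r : ℤ) ≤ x 1 ∧ x 1 ≤ 2 * (r : ℤ) ∧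
              -(2 * (r : ℤ)) ≤ x 2 ∧ x 2 ≤ 3 * ((r : ℤ) / 8)}
            (0 : Site 3) ![(r : ℤ), (r : ℤ), 0]))
    (hGlue : ∃ c : ℝ, 0 < c ∧ ∃ r₀ : ℕ, ∀ r : ℕ, r₀ ≤ r →
      c * (bondPercolation (zdGraph 3) (criticalProbI 3)).real
          (openConnIn
              {x : Site 3 | -(r : ℤ) ≤ x 0 ∧ x 0 ≤ 2 * (r : ℤ) ∧ -(r : ℤ) ≤ x 1 ∧ x 1 ≤ 2 * (r : ℤ) ∧
                -(2 * (r : ℤ)) ≤ x 2 ∧ x 2 ≤ 3 * ((r : ℤ) / 8)}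
              (0 : Site 3) ![(r : ℤ), (r : ℤ), 0] ∩
            openConnIn {x : Site 3 | (r : ℤ) - 3 * ((r : ℤ) / 8) ≤ x 2}
              (![(r : ℤ), 0, (r : ℤ)] : Site 3) ![0, (r : ℤ), (r : ℤ)]) ≤
        (bondPercolation (zdGraph 3) (criticalProbI 3)).real
          (openConnIn
              {x : Site 3 | -(r : ℤ) ≤ x 0 ∧ x 0 ≤ 2 * (r : ℤ) ∧ -(r : ℤ) ≤ x 1 ∧ x 1 ≤ 2 * (r : ℤ) ∧
                -(2 * (r : ℤ)) ≤ x 2 ∧ x 2 ≤ 3 * ((r : ℤ) / 8)}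
              (0 : Site 3) ![(r : ℤ), (r : ℤ), 0] ∩
            openConnIn {x : Site 3 | (r : ℤ) - 3 * ((r : ℤ) / 8) ≤ x 2}
              (![(r : ℤ), 0, (r : ℤ)] : Site 3) ![0, (r : ℤ), (r : ℤ)] ∩
            openConn (0 : Site 3) ![(r : ℤ), 0, (r : ℤ)])) :
    ∃ δ : ℝ, 0 < δ ∧ ∃ r₀ : ℕ, ∀ r : ℕ, r₀ ≤ r →
      (1 + δ) * tau 3 (criticalProbI 3) 0 ![(r : ℤ), (r : ℤ), 0] *
          tau 3 (criticalProbI 3) ![(r : ℤ), 0, (r : ℤ)] ![0, (r : ℤ), (r : ℤ)] ≤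
        (bondPercolation (zdGraph 3) (criticalProbI 3)).real
          (openConn 0 ![(r : ℤ), (r : ℤ), 0] ∩ openConn ![(r : ℤ), 0, (r : ℤ)] ![0, (r : ℤ), (r : ℤ)]) := by
  obtain ⟨cS, hcS, hShell⟩ := stub_collarShellProbability hXB
  obtain ⟨c, hc, r₁, hC⟩ := hBox
  obtain ⟨cg, hcg, r₂, hG⟩ := hGlue
  -- the threshold `κ = c_g / 2` and the gap `δ`
  set κ : ℝ := cg / 2 with hκ
  have hκpos : 0 < κ := by positivity
  refine ⟨κ * κ * cS * c ^ 2, by positivity, max (max r₁ r₂) 64, fun r hr => ?_⟩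
  have hr₁ : r₁ ≤ r := le_trans (le_trans (le_max_left _ _) (le_max_left _ _)) hr
  have hr₂ : r₂ ≤ r := le_trans (le_trans (le_max_right _ _) (le_max_left _ _)) hr
  have hr64 : 64 ≤ r := le_trans (le_max_right _ _) hr
  -- instances of the three inputs at `r`, and the lattice symmetries of `T_r`
  have hSh := hShell r hr64
  have hA := hC r hr₁
  have hGr := hG r hr₂
  clear hShell hC hG
  obtain ⟨hcross, hτ0b, hτac⟩ := stub_crossedPairSymmetry (criticalProbI 3) r
  have hτbc := tau_opposite_edge_eq (criticalProbI 3) r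
  have hm := stub_mirrorRestrict (criticalProbI 3) r ((r : ℤ) - 3 * ((r : ℤ) / 8))
  -- the objects
  set av : Site 3 := ![(r : ℤ), (r : ℤ), 0] with hav
  set bv : Site 3 := ![(r : ℤ), 0, (r : ℤ)] with hbv
  set cv : Site 3 := ![0, (r : ℤ), (r : ℤ)] with hcv
  set R : Set (Site 3) :=
    {x : Site 3 | -(r : ℤ) ≤ x 0 ∧ x 0 ≤ 2 * (r : ℤ) ∧ -(r : ℤ) ≤ x 1 ∧ x 1 ≤ 2 * (r : ℤ) ∧
      -(2 * (r : ℤ)) ≤ x 2 ∧ x 2 ≤ 3 * ((r : ℤ) / 8)} with hR_def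
  set R' : Set (Site 3) :=
    {x : Site 3 | -(r : ℤ) - (2 * ((r : ℤ) / 8) - 1) ≤ x 0 ∧ x 0 ≤ 2 * (r : ℤ) + (2 * ((r : ℤ) / 8) - 1) ∧
      -(r : ℤ) - (2 * ((r : ℤ) / 8) - 1) ≤ x 1 ∧ x 1 ≤ 2 * (r : ℤ) + (2 * ((r : ℤ) / 8) - 1) ∧
      -(2 * (r : ℤ)) - (2 * ((r : ℤ) / 8) - 1) ≤ x 2 ∧ x 2 ≤ 5 * ((r : ℤ) / 8) - 1} with hR'_def
  set U : Set (Site 3) := {x : Site 3 | (r : ℤ) - 3 * ((r : ℤ) / 8) ≤ x 2} with hU_def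
  set Sh : Set (BondConfig (Site 3)) :=
    {ω | ∀ u ∈ R' \ R, ∀ w ∈ R' \ R, (∃ z ∈ R, (zdGraph 3).Adj u z) →
      (∃ z ∉ R', (zdGraph 3).Adj w z) → ω ∉ openConnIn (R' \ R) u w} with hSh_def
  -- membership unfolding
  have mem_R : ∀ u : Site 3, u ∈ R ↔
      -(r : ℤ) ≤ u 0 ∧ u 0 ≤ 2 * (r : ℤ) ∧ -(r : ℤ) ≤ u 1 ∧ u 1 ≤ 2 * (r : ℤ) ∧
      -(2 * (r : ℤ)) ≤ u 2 ∧ u 2 ≤ 3 * ((r : ℤ) / 8) := fun u => Iff.rfl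
  have mem_R' : ∀ u : Site 3, u ∈ R' ↔
      -(r : ℤ) - (2 * ((r : ℤ) / 8) - 1) ≤ u 0 ∧ u 0 ≤ 2 * (r : ℤ) + (2 * ((r : ℤ) / 8) - 1) ∧
      -(r : ℤ) - (2 * ((r : ℤ) / 8) - 1) ≤ u 1 ∧ u 1 ≤ 2 * (r : ℤ) + (2 * ((r : ℤ) / 8) - 1) ∧
      -(2 * (r : ℤ)) - (2 * ((r : ℤ) / 8) - 1) ≤ u 2 ∧ u 2 ≤ 5 * ((r : ℤ) / 8) - 1 := fun u => Iff.rfl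
  have mem_U : ∀ u : Site 3, u ∈ U ↔ (r : ℤ) - 3 * ((r : ℤ) / 8) ≤ u 2 := fun u => Iff.rfl
  -- geometry
  have hRR' : R ⊆ R' := by
    intro u hu
    rw [mem_R] at hu
    rw [mem_R']
    omega
  have hN : ∀ x ∈ R, ∀ y, (zdGraph 3).Adj x y → y ∈ R' := by
    intro x hx y hxy
    rw [mem_R] at hx
    rw [mem_R']
    have h0 := zdGraph_adj_apply_le hxy 0
    have h1 := zdGraph_adj_apply_le hxy 1
    have h2 := zdGraph_adj_apply_le hxy 2
    omega
  have hR'U : Disjoint R' U := by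
    rw [Set.disjoint_left]
    intro u hu huU
    rw [mem_R'] at hu
    rw [mem_U] at huU
    omega
  have hRU : Disjoint R U := Set.disjoint_of_subset_left hRR' hR'U
  have hRW : R ⊆ {x : Site 3 | x 2 ≤ (r : ℤ) - ((r : ℤ) - 3 * ((r : ℤ) / 8))} := by
    intro u hu
    rw [mem_R] at hu
    simp only [Set.mem_setOf_eq]
    omega
  have h0R : (0 : Site 3) ∈ R := by
    rw [mem_R]
    simp only [Pi.zero_apply]
    omega
  -- the block: all pairs inside the (finite) collar `R' ∖ R`
  have hfin : (R' \ R).Finite := by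
    refine (Set.finite_Icc (fun _ : Fin 3 => -(3 * (r : ℤ))) (fun _ : Fin 3 => 3 * (r : ℤ))).subset ?_
    intro u hu
    have hu' := hu.1
    rw [mem_R'] at hu'
    simp only [Set.mem_Icc]
    refine ⟨fun i => ?_, fun i => ?_⟩ <;> fin_cases i <;>
      simp only [Fin.zero_eta, Fin.mk_one, Fin.reduceFinMk, Fin.isValue] <;> omega
  set K : Finset (Sym2 (Site 3)) := hfin.toFinset.sym2 with hK_def
  have hKcoe : (↑K : Set (Sym2 (Site 3))) = (R' \ R).sym2 := by
    rw [hK_def, Finset.coe_sym2, Set.Finite.coe_toFinset]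
  have hKR : Disjoint (↑K : Set (Sym2 (Site 3))) R.sym2 := by
    rw [hKcoe]
    exact restrictProduct_disjoint_sym2 Set.disjoint_sdiff_left
  have hKU : Disjoint (↑K : Set (Sym2 (Site 3))) U.sym2 := by
    rw [hKcoe]
    exact restrictProduct_disjoint_sym2 (Set.disjoint_of_subset_left Set.sdiff_subset hR'U)
  -- the events
  set A' : Set (BondConfig (Site 3)) := openConn (0 : Site 3) bv with hA'_def
  set B' : Set (BondConfig (Site 3)) := openConn av cv with hB'_def
  set Wev : Set (BondConfig (Site 3)) := openConnIn R (0 : Site 3) av ∩ openConnIn U bv cv with hWev_def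
  set f : BondConfig (Site 3) → ℝ := blockCondProb (zdGraph 3) (criticalProbI 3) K A' with hf_def
  set g : BondConfig (Site 3) → ℝ := blockCondProb (zdGraph 3) (criticalProbI 3) K B' with hg_def
  set h : BondConfig (Site 3) → ℝ := blockCondProb (zdGraph 3) (criticalProbI 3) K (A' ∩ B') with hh_def
  set S : Set (BondConfig (Site 3)) := Wev ∩ {ω | κ ≤ f ω} with hS_def
  -- measurability, monotonicity, supports
  have hA'm : MeasurableSet A' := measurableSet_openConn_holds _ _
  have hB'm : MeasurableSet B' := measurableSet_openConn_holds _ _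
  have hA'u : IsUpperSet A' := isUpperSet_openConn _ _
  have hB'u : IsUpperSet B' := isUpperSet_openConn _ _
  have hWm : MeasurableSet Wev :=
    (restrictProduct_measurableSet_openConnIn R (0 : Site 3) av).inter
      (restrictProduct_measurableSet_openConnIn U bv cv)
  have hfm : Measurable f := measurable_blockCondProb (zdGraph 3) (criticalProbI 3) K hA'm
  have hSm : MeasurableSet S := hWm.inter (measurableSet_le measurable_const hfm)
  have hShm : MeasurableSet Sh := shellDecoupling_measurableSet_shell (zdGraph 3) R R'
  have hWdet : DeterminedBy Wev (↑K : Set (Sym2 (Site 3)))ᶜ :=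
    (DCT16.determinedBy_openConnIn R (0 : Site 3) av hKR.subset_compl_left).inter
      (DCT16.determinedBy_openConnIn U bv cv hKU.subset_compl_left)
  have hSdet : DeterminedBy S (↑K : Set (Sym2 (Site 3)))ᶜ :=
    hWdet.inter ((stub_determinedBy_blockCondProb (zdGraph 3) (criticalProbI 3) K A').2 κ)
  have hShdet : DeterminedBy Sh (↑K : Set (Sym2 (Site 3))) :=
    shellDecoupling_determinedBy_shell (zdGraph 3) R R' (K := ↑K) (by rw [hKcoe])
  have hf0 : ∀ ω, 0 ≤ f ω := fun ω => blockCondProb_nonneg _ _ _ _ ω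
  have hf1 : ∀ ω, f ω ≤ 1 := fun ω => blockCondProb_le_one _ _ _ _ ω
  -- (1) on `W` the three conditional probabilities coincide
  have hcoin : ∀ ω ∈ Wev, g ω = f ω ∧ h ω = f ω := fun ω hω =>
    stub_offCollarIdentity (zdGraph 3) (criticalProbI 3) K R U (0 : Site 3) av bv cv hKR hKU ω hω
  -- (2) pointwise lower bound for the conditional covariance
  have hpt : ∀ ω, κ * (S.indicator (fun _ => (1 : ℝ)) ω - S.indicator (fun _ => (1 : ℝ)) ω * f ω) ≤
      h ω - f ω * g ω := by
    intro ω
    by_cases hω : ω ∈ S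
    · obtain ⟨hg, hh⟩ := hcoin ω hω.1
      have hκf : κ ≤ f ω := hω.2
      rw [Set.indicator_of_mem hω, hg, hh]
      nlinarith [hf1 ω, hκf]
    · rw [Set.indicator_of_notMem hω]
      have := blockCondProb_mul_blockCondProb_le (zdGraph 3) (criticalProbI 3) K hA'u hB'u ω
      simp only [zero_mul, sub_zero, mul_zero]
      linarith
  -- integrability
  have hSind : Integrable (S.indicator fun _ => (1 : ℝ)) (bondPercolation (zdGraph 3) (criticalProbI 3)) := (integrable_const (1 : ℝ)).indicator hSm
  have hWind : Integrable (Wev.indicator fun _ => (1 : ℝ)) (bondPercolation (zdGraph 3) (criticalProbI 3)) := (integrable_const (1 : ℝ)).indicator hWm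
  have hSf_eq : (fun ω => S.indicator (fun _ => (1 : ℝ)) ω * f ω) =
      blockCondProb (zdGraph 3) (criticalProbI 3) K (A' ∩ S) :=
    funext fun ω => indicator_mul_blockCondProb_eq (zdGraph 3) (criticalProbI 3) K A' hSdet ω
  have hWf_eq : (fun ω => Wev.indicator (fun _ => (1 : ℝ)) ω * f ω) =
      blockCondProb (zdGraph 3) (criticalProbI 3) K (A' ∩ Wev) :=
    funext fun ω => indicator_mul_blockCondProb_eq (zdGraph 3) (criticalProbI 3) K A' hWdet ω
  have hSf_int : Integrable (fun ω => S.indicator (fun _ => (1 : ℝ)) ω * f ω) (bondPercolation (zdGraph 3) (criticalProbI 3)) := by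
    rw [hSf_eq]
    exact integrable_blockCondProb _ _ K (hA'm.inter hSm)
  have hWf_int : Integrable (fun ω => Wev.indicator (fun _ => (1 : ℝ)) ω * f ω) (bondPercolation (zdGraph 3) (criticalProbI 3)) := by
    rw [hWf_eq]
    exact integrable_blockCondProb _ _ K (hA'm.inter hWm)
  have hh_int : Integrable h (bondPercolation (zdGraph 3) (criticalProbI 3)) := integrable_blockCondProb _ _ K (hA'm.inter hB'm)
  have hfg_int : Integrable (fun ω => f ω * g ω) (bondPercolation (zdGraph 3) (criticalProbI 3)) := integrable_blockCondProb_mul _ _ K hA'm hB'm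
  -- integrals of the indicator pieces
  have hint_S : ∫ ω, S.indicator (fun _ => (1 : ℝ)) ω ∂(bondPercolation (zdGraph 3) (criticalProbI 3)) = (bondPercolation (zdGraph 3) (criticalProbI 3)).real S := by
    rw [integral_indicator_const _ hSm, smul_eq_mul, mul_one]
  have hint_W : ∫ ω, Wev.indicator (fun _ => (1 : ℝ)) ω ∂(bondPercolation (zdGraph 3) (criticalProbI 3)) = (bondPercolation (zdGraph 3) (criticalProbI 3)).real Wev := by
    rw [integral_indicator_const _ hWm, smul_eq_mul, mul_one]
  have hint_Sf : ∫ ω, S.indicator (fun _ => (1 : ℝ)) ω * f ω ∂(bondPercolation (zdGraph 3) (criticalProbI 3)) = (bondPercolation (zdGraph 3) (criticalProbI 3)).real (A' ∩ S) :=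
    stub_setIntegral_blockCondProb (zdGraph 3) (criticalProbI 3) K hA'm hSm hSdet
  have hint_Wf : ∫ ω, Wev.indicator (fun _ => (1 : ℝ)) ω * f ω ∂(bondPercolation (zdGraph 3) (criticalProbI 3)) = (bondPercolation (zdGraph 3) (criticalProbI 3)).real (A' ∩ Wev) :=
    stub_setIntegral_blockCondProb (zdGraph 3) (criticalProbI 3) K hA'm hWm hWdet
  have hint_h : ∫ ω, h ω ∂(bondPercolation (zdGraph 3) (criticalProbI 3)) = (bondPercolation (zdGraph 3) (criticalProbI 3)).real (A' ∩ B') := integral_blockCondProb_eq _ _ K (hA'm.inter hB'm)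
  have hint_fg : (bondPercolation (zdGraph 3) (criticalProbI 3)).real A' * (bondPercolation (zdGraph 3) (criticalProbI 3)).real B' ≤ ∫ ω, f ω * g ω ∂(bondPercolation (zdGraph 3) (criticalProbI 3)) :=
    measureReal_mul_le_integral_blockCondProb_mul (zdGraph 3) (criticalProbI 3) K hA'u hB'u hA'm hB'm
  -- (3) the covariance bound: `κ (P(S) − P(A' ∩ S)) ≤ P(A'∩B') − P(A')P(B')`
  have hcov : κ * ((bondPercolation (zdGraph 3) (criticalProbI 3)).real S -
      (bondPercolation (zdGraph 3) (criticalProbI 3)).real (A' ∩ S)) ≤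
      (bondPercolation (zdGraph 3) (criticalProbI 3)).real (A' ∩ B') -
        (bondPercolation (zdGraph 3) (criticalProbI 3)).real A' * (bondPercolation (zdGraph 3) (criticalProbI 3)).real B' := by
    have hint1 : Integrable (fun ω => κ * (S.indicator (fun _ => (1 : ℝ)) ω - S.indicator (fun _ => (1 : ℝ)) ω * f ω))
        (bondPercolation (zdGraph 3) (criticalProbI 3)) := (hSind.sub hSf_int).const_mul κ
    have hint2 : Integrable (fun ω => h ω - f ω * g ω) (bondPercolation (zdGraph 3) (criticalProbI 3)) :=
      hh_int.sub hfg_int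
    have hI := integral_mono hint1 hint2 hpt
    have hL : ∫ ω, κ * (S.indicator (fun _ => (1 : ℝ)) ω - S.indicator (fun _ => (1 : ℝ)) ω * f ω)
        ∂(bondPercolation (zdGraph 3) (criticalProbI 3)) =
        κ * ((bondPercolation (zdGraph 3) (criticalProbI 3)).real S -
          (bondPercolation (zdGraph 3) (criticalProbI 3)).real (A' ∩ S)) := by
      rw [integral_const_mul, integral_sub hSind hSf_int, hint_S, hint_Sf]
    have hR : ∫ ω, (h ω - f ω * g ω) ∂(bondPercolation (zdGraph 3) (criticalProbI 3)) =
        (bondPercolation (zdGraph 3) (criticalProbI 3)).real (A' ∩ B') -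
          ∫ ω, f ω * g ω ∂(bondPercolation (zdGraph 3) (criticalProbI 3)) := by
      rw [integral_sub hh_int hfg_int, hint_h]
    rw [hL, hR] at hI
    linarith
  -- (4) `P(S) − P(A' ∩ S) = P(S ∖ A') ≥ P(S ∩ Shell) = P(S) P(Shell) ≥ P(S) c_S`
  have hdiff : (bondPercolation (zdGraph 3) (criticalProbI 3)).real S - (bondPercolation (zdGraph 3) (criticalProbI 3)).real (A' ∩ S) = (bondPercolation (zdGraph 3) (criticalProbI 3)).real (S \ A') := by
    have := measureReal_inter_add_sdiff (μ := bondPercolation (zdGraph 3) (criticalProbI 3)) (s := S) hA'm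
    rw [Set.inter_comm] at this
    linarith
  have hsep : (bondPercolation (zdGraph 3) (criticalProbI 3)).real (S ∩ Sh) ≤ (bondPercolation (zdGraph 3) (criticalProbI 3)).real (S \ A') := by
    rw [← real_preimage_inter_edgeSet (zdGraph 3) (criticalProbI 3) (S ∩ Sh),
      ← real_preimage_inter_edgeSet (zdGraph 3) (criticalProbI 3) (S \ A')]
    refine measureReal_mono (fun ω hω => ?_)
    simp only [Set.mem_preimage, Set.mem_inter_iff, Set.mem_sdiff] at hω ⊢
    obtain ⟨hωS, hωSh⟩ := hω
    refine ⟨hωS, ?_⟩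
    have key := shellDecoupling_subset (zdGraph 3) hRR' hN hR'U (0 : Site 3) av bv cv
      Set.inter_subset_right hωS.1.1 hωSh hωS.1.2
    exact key.2
  have hindep : (bondPercolation (zdGraph 3) (criticalProbI 3)).real (S ∩ Sh) = (bondPercolation (zdGraph 3) (criticalProbI 3)).real S * (bondPercolation (zdGraph 3) (criticalProbI 3)).real Sh :=
    bondPercolation_real_inter_of_disjoint (zdGraph 3) (criticalProbI 3) disjoint_compl_left hSdet hShdet hSm hShm
  have hShell_ge : cS ≤ (bondPercolation (zdGraph 3) (criticalProbI 3)).real Sh := hSh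
  -- (5) `P(S) ≥ (c_g − κ) P(W)` from restricted gluing
  have hglue : cg * (bondPercolation (zdGraph 3) (criticalProbI 3)).real Wev ≤ (bondPercolation (zdGraph 3) (criticalProbI 3)).real (A' ∩ Wev) := by
    rw [Set.inter_comm]
    exact hGr
  have hWsplit : (bondPercolation (zdGraph 3) (criticalProbI 3)).real (A' ∩ Wev) ≤
      κ * (bondPercolation (zdGraph 3) (criticalProbI 3)).real Wev + (bondPercolation (zdGraph 3) (criticalProbI 3)).real S := by
    have hint3 : Integrable (fun ω => κ * Wev.indicator (fun _ => (1 : ℝ)) ω + S.indicator (fun _ => (1 : ℝ)) ω)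
        (bondPercolation (zdGraph 3) (criticalProbI 3)) := (hWind.const_mul κ).add hSind
    have hE : ∫ ω, (κ * Wev.indicator (fun _ => (1 : ℝ)) ω + S.indicator (fun _ => (1 : ℝ)) ω)
        ∂(bondPercolation (zdGraph 3) (criticalProbI 3)) =
        κ * (bondPercolation (zdGraph 3) (criticalProbI 3)).real Wev + (bondPercolation (zdGraph 3) (criticalProbI 3)).real S := by
      have hint4 : Integrable (fun ω => κ * Wev.indicator (fun _ => (1 : ℝ)) ω)
          (bondPercolation (zdGraph 3) (criticalProbI 3)) := hWind.const_mul κ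
      rw [integral_add hint4 hSind, integral_const_mul, hint_W, hint_S]
    rw [← hint_Wf, ← hE]
    refine integral_mono hWf_int hint3 fun ω => ?_
    by_cases hω : ω ∈ Wev
    · rw [Set.indicator_of_mem hω]
      by_cases hκf : κ ≤ f ω
      · have hS' : ω ∈ S := ⟨hω, hκf⟩
        rw [Set.indicator_of_mem hS']
        nlinarith [hf1 ω, hκpos.le]
      · push Not at hκf
        have h0 : 0 ≤ S.indicator (fun _ => (1 : ℝ)) ω := Set.indicator_nonneg (fun _ _ => zero_le_one) ω
        nlinarith [h0]
    · rw [Set.indicator_of_notMem hω]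
      have h0 : 0 ≤ S.indicator (fun _ => (1 : ℝ)) ω := Set.indicator_nonneg (fun _ _ => zero_le_one) ω
      nlinarith [h0]
  have hS_ge : κ * (bondPercolation (zdGraph 3) (criticalProbI 3)).real Wev ≤ (bondPercolation (zdGraph 3) (criticalProbI 3)).real S := by
    have hcgκ : cg = κ + κ := by rw [hκ]; ring
    rw [hcgκ, add_mul] at hglue
    linarith [hglue, hWsplit]
  -- (6) `P(W) = P(0↔a in R) P(b↔c in U) ≥ (c τ)²`
  have hWprod : (bondPercolation (zdGraph 3) (criticalProbI 3)).real Wev = (bondPercolation (zdGraph 3) (criticalProbI 3)).real (openConnIn R (0 : Site 3) av) * (bondPercolation (zdGraph 3) (criticalProbI 3)).real (openConnIn U bv cv) :=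
    stub_restrictProduct (zdGraph 3) (criticalProbI 3) hRU (0 : Site 3) av bv cv
  have hB : c * tau 3 (criticalProbI 3) 0 av ≤ (bondPercolation (zdGraph 3) (criticalProbI 3)).real (openConnIn U bv cv) := by
    rw [hm]
    exact le_trans hA (measureReal_mono (openConnIn_mono hRW _ _))
  set τ : ℝ := tau 3 (criticalProbI 3) 0 av with hτ
  have hτnn : 0 ≤ τ := tau_nonneg _ _ _
  have hcτ : 0 ≤ c * τ := by positivity
  have hW_ge : (c * τ) * (c * τ) ≤ (bondPercolation (zdGraph 3) (criticalProbI 3)).real Wev := by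
    rw [hWprod]
    exact mul_le_mul hA hB hcτ measureReal_nonneg
  -- (7) symmetries of `T_r` and assembly
  have hPA' : (bondPercolation (zdGraph 3) (criticalProbI 3)).real A' = τ := by
    rw [hA'_def, ← tau_def, hτ0b]
  have hPB' : (bondPercolation (zdGraph 3) (criticalProbI 3)).real B' = τ := by
    rw [hB'_def, ← tau_def, hτac]
  rw [hτbc, hcross]
  rw [hPA', hPB', hdiff] at hcov
  have hPSnn : 0 ≤ (bondPercolation (zdGraph 3) (criticalProbI 3)).real S := measureReal_nonneg
  have f1 : κ * ((bondPercolation (zdGraph 3) (criticalProbI 3)).real S *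
      (bondPercolation (zdGraph 3) (criticalProbI 3)).real Sh) ≤
      κ * (bondPercolation (zdGraph 3) (criticalProbI 3)).real (S \ A') := by
    rw [← hindep]
    exact mul_le_mul_of_nonneg_left hsep hκpos.le
  have e3 : κ * ((bondPercolation (zdGraph 3) (criticalProbI 3)).real S * cS) ≤
      κ * ((bondPercolation (zdGraph 3) (criticalProbI 3)).real S * (bondPercolation (zdGraph 3) (criticalProbI 3)).real Sh) :=
    mul_le_mul_of_nonneg_left (mul_le_mul_of_nonneg_left hShell_ge hPSnn) hκpos.le
  have e2 : κ * ((κ * (bondPercolation (zdGraph 3) (criticalProbI 3)).real Wev) * cS) ≤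
      κ * ((bondPercolation (zdGraph 3) (criticalProbI 3)).real S * cS) :=
    mul_le_mul_of_nonneg_left (mul_le_mul_of_nonneg_right hS_ge hcS.le) hκpos.le
  have e1 : κ * ((κ * ((c * τ) * (c * τ))) * cS) ≤
      κ * ((κ * (bondPercolation (zdGraph 3) (criticalProbI 3)).real Wev) * cS) :=
    mul_le_mul_of_nonneg_left (mul_le_mul_of_nonneg_right (mul_le_mul_of_nonneg_left hW_ge hκpos.le) hcS.le)
      hκpos.le
  have e0 : (1 + κ * κ * cS * c ^ 2) * τ * τ = τ * τ + κ * ((κ * ((c * τ) * (c * τ))) * cS) := by ring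
  rw [e0]
  linarith [hcov, f1, e3, e2, e1]

end Summit.CriticalPhenomena.PercolationContinuityZ3.Theorems.TetrahedronHarrisGap


end
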